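import Summits.ResolutionOfSingularities.ResolutionOfSingularities.Theorems.FrobeniusClosingPatchingRelPerfectMonomialRouteKChartAlgebra
import Literature.AlgebraicGeometry.Resolution.CoordinateBlowupChart
import Mathlib.RingTheory.Ideal.Colon
import HarnessLib

/-!
# Crux `PatchingRelPerfect` (stmt-ResolutionOfSingularities-16161), chain w52 — TargetsF3 (m)
# «M2-strong», COMBINATORIAL HALF, Route K step K12: the blow-up SUBSTITUTION on monomial ideals —
# strict and controlled transforms computed in the polynomial ring

[OURS · L1 W5.2 · design memo v3 (`L/res-type-075/M2STRONG-COMBINATORIAL-HALF.md`); fact-free;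
nothing here is a statement of the manuscript under review]

In a chart of the blow-up of `Spec ℚ[x]` along `(x_i : i ∈ S)` (file K11: the chart of `x_j`, `j ∈ S`,
is `Spec ℚ[x]` with structure map Hu's substitution `subst_j : x_i ↦ x_j x_i`, `i ∈ S ∖ j`), the
exceptional divisor is `(x_j)`, and the transforms of the boundary and of the monomial ideal are read by
saturating / dividing by `x_j`.  This file is that algebra in `K[x_σ]` (`K` a field):

* `coordBlowupSubst_monomial` — `subst_j (x^β) = x^{β + |β_{S∖j}| e_j}`;
* `iSup_colon_span_X_pow_*` — `⋃ₙ ((x_j x_b) : x_jⁿ) = (x_b)`, `⋃ₙ ((x_b) : x_jⁿ) = (x_b)` (`b ≠ j`),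
  `⋃ₙ ((x_j) : x_jⁿ) = ⊤` (strict transforms of the coordinate hyperplanes);
* `colon_span_singleton_mul` — `(a·K : a) = K` for a non-zero-divisor `a`;
* **`colon_map_subst_monIdeal`** — for exponent vectors `β` with `|β_S| ≥ m`:
  `(subst_j (x^β : β ∈ A) : x_j^m) = (x^{β + (|β_{S∖j}| - m... )}: β ∈ A)` precisely
  `x^{β'}` with `β'_j = |β_S| - m`, `β'_b = β_b` (`b ≠ j`) — the controlled transform with marking `m`
  of a sum of monomials is the sum of the moved monomials (game move `moveExp`, file 1).
-/

-- `Summit.<Summit>.<Sub>.Theorems` with `Sub = Summit` (single-conjunct summit, D-0017)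
set_option linter.dupNamespace false

noncomputable section

open MvPolynomial Literature.AlgebraicGeometry.Resolution

namespace Summit.ResolutionOfSingularities.ResolutionOfSingularities.Theorems

namespace PolyhedraGame

namespace RouteK

variable {σ : Type*} [DecidableEq σ] {K : Type*} [Field K]

/-! ## The substitution on monomials -/

/-- [OURS] **Hu's substitution on a monomial**: `subst_j (x^β) = x^{β + |β_{S∖j}| e_j}`. -/
theorem coordBlowupSubst_monomial (S : Finset σ) (j : σ) (β : σ →₀ ℕ) :
    coordBlowupSubst K (S : Set σ) j (monomial β 1) =
      monomial (β + Finsupp.single j (sdeg (S.erase j) β)) 1 := by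
  rw [← prod_X_pow_eq_monomial, map_prod]
  -- each factor `subst (x_i)^{β i}` is `x_j^{[i ∈ S∖j] β i} · x_i^{β i}`
  have hfac : ∀ i ∈ β.support, coordBlowupSubst K (S : Set σ) j (X i ^ β i) =
      X j ^ (if i ∈ S.erase j then β i else 0) * X i ^ β i := by
    intro i _
    rw [map_pow]
    by_cases h : i ∈ S.erase j
    · rw [if_pos h, coordBlowupSubst_X_of_mem_of_ne K (S : Set σ) j
        (Finset.mem_coe.mpr (Finset.mem_erase.mp h).2) (Finset.mem_erase.mp h).1, mul_pow]
    · rw [if_neg h, pow_zero, one_mul]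
      by_cases hij : i = j
      · subst hij; rw [coordBlowupSubst_X_self]
      · rw [coordBlowupSubst_X_of_not_mem K (S : Set σ) j (fun h' => h
          (Finset.mem_erase.mpr ⟨hij, Finset.mem_coe.mp h'⟩))]
  -- the exponent of `x_j`: `Σ_{i ∈ supp β} [i ∈ S∖j] β i = Σ_{i ∈ S∖j} β i`
  have hsum : (∑ i ∈ β.support, if i ∈ S.erase j then β i else 0) = sdeg (S.erase j) β := by
    rw [Finset.sum_ite_mem, sdeg]
    apply Finset.sum_subset Finset.inter_subset_right
    intro i _ hi'
    rw [Finset.mem_inter, not_and'] at hi'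
    by_contra h0
    exact hi' ‹_› (Finsupp.mem_support_iff.mpr h0)
  rw [Finset.prod_congr rfl hfac, Finset.prod_mul_distrib, Finset.prod_pow_eq_pow_sum, hsum,
    prod_X_pow_eq_monomial, X_pow_eq_monomial, monomial_mul, one_mul, add_comm]

/-- [OURS] The `S`-degree of the substituted exponent at `j` is the full `S`-degree. -/
theorem add_single_apply_self_eq_sdeg (S : Finset σ) {j : σ} (hj : j ∈ S) (β : σ →₀ ℕ) :
    (β + Finsupp.single j (sdeg (S.erase j) β)) j = sdeg S β := by
  rw [Finsupp.add_apply, Finsupp.single_eq_same, sdeg, sdeg, ← Finset.add_sum_erase S _ hj]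

/-! ## Colon ideals by powers of a variable -/

omit [DecidableEq σ] in
/-- [OURS] `(a · I : a) = I` for a non-zero-divisor `a`. -/
theorem colon_span_singleton_mul {R : Type*} [CommRing R] {a : R} (ha : a ∈ nonZeroDivisors R) (I : Ideal R) :
    (Ideal.span {a} * I).colon (Ideal.span {a} : Set R) = I := by
  ext r
  rw [Ideal.colon_span, Submodule.mem_colon_singleton, smul_eq_mul]
  constructor
  · intro h
    rw [Ideal.mem_span_singleton_mul] at h
    obtain ⟨z, hz, hza⟩ := h
    have : z = r := (mul_cancel_left_mem_nonZeroDivisors ha).mp (hza.trans (mul_comm r a))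
    exact this ▸ hz
  · intro h
    rw [mul_comm r a]
    exact Ideal.mul_mem_mul (Ideal.mem_span_singleton_self a) h

omit [DecidableEq σ] in
/-- [OURS] A prime ideal is saturated with respect to an element outside it. -/
theorem colon_eq_self_of_isPrime {R : Type*} [CommRing R] {P : Ideal R} (hP : P.IsPrime) {a : R}
    (ha : a ∉ P) : P.colon (Ideal.span {a} : Set R) = P := by
  ext r
  rw [Ideal.colon_span, Submodule.mem_colon_singleton, smul_eq_mul]
  constructor
  · intro h; exact (hP.mem_or_mem (by rwa [mul_comm r a] at h)).resolve_left ha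
  · intro h; exact P.mul_mem_right a h

/-- [OURS] `x_b ∈ (x_i : i ∈ T)` iff `b ∈ T`. -/
theorem X_mem_coordIdeal_iff' (T : Finset σ) (b : σ) :
    (X b : MvPolynomial σ K) ∈ coordIdeal T ↔ b ∈ T := by
  rw [mem_coordIdeal_iff, support_X]
  simp only [Finset.mem_singleton, forall_eq, one_le_sdeg_iff, Finsupp.single_apply, ne_eq,
    ite_eq_right_iff, one_ne_zero, imp_false, not_not]
  exact ⟨fun ⟨i, hi, h⟩ => h ▸ hi, fun h => ⟨b, h, rfl⟩⟩

omit [DecidableEq σ] in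
/-- [OURS] The coordinate hyperplane ideal `(x_b)` is the coordinate ideal of `{b}`, hence prime. -/
theorem span_X_eq_coordIdeal (b : σ) : Ideal.span {(X b : MvPolynomial σ K)} = coordIdeal {b} := by
  rw [coordIdeal, Finset.coe_singleton, Set.image_singleton]

/-- [OURS] `(x_b)` is prime. -/
theorem isPrime_span_X (b : σ) : (Ideal.span {(X b : MvPolynomial σ K)}).IsPrime := by
  rw [span_X_eq_coordIdeal]; exact coordIdeal_isPrime _

/-- [OURS] `x_j^n ∉ (x_b)` for `b ≠ j`. -/
theorem X_pow_notMem_span_X {b j : σ} (hbj : b ≠ j) (n : ℕ) :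
    (X j : MvPolynomial σ K) ^ n ∉ Ideal.span {(X b : MvPolynomial σ K)} := by
  intro h
  have := (isPrime_span_X (K := K) b).mem_of_pow_mem n h
  rw [span_X_eq_coordIdeal, X_mem_coordIdeal_iff', Finset.mem_singleton] at this
  exact hbj this.symm

/-- [OURS] **Strict transform of a transversal coordinate hyperplane**: `⋃ₙ ((x_b) : x_jⁿ) = (x_b)` for
`b ≠ j`. -/
theorem iSup_colon_span_X (b j : σ) (hbj : b ≠ j) :
    ⨆ n : ℕ, (Ideal.span {(X b : MvPolynomial σ K)}).colon (↑(Ideal.span {(X j : MvPolynomial σ K) ^ n}) : Set (MvPolynomial σ K)) =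
      Ideal.span {X b} := by
  apply le_antisymm
  · exact iSup_le fun n => (colon_eq_self_of_isPrime (isPrime_span_X b) (X_pow_notMem_span_X hbj n)).le
  · exact le_iSup_of_le 0 Ideal.le_colon

/-- [OURS] **Strict transform of a centre hyperplane other than the chart's**: `⋃ₙ ((x_j x_b) : x_jⁿ) = (x_b)`
for `b ≠ j`. -/
theorem iSup_colon_span_X_mul_X (b j : σ) (hbj : b ≠ j) :
    ⨆ n : ℕ, (Ideal.span {(X j * X b : MvPolynomial σ K)}).colon (↑(Ideal.span {(X j : MvPolynomial σ K) ^ n}) : Set (MvPolynomial σ K)) =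
      Ideal.span {X b} := by
  apply le_antisymm
  · refine iSup_le fun n => ?_
    intro r hr
    rw [Ideal.colon_span, Submodule.mem_colon_singleton, smul_eq_mul, Ideal.mem_span_singleton] at hr
    -- `x_j x_b ∣ r x_j^n` ⇒ `x_b ∣ r x_j^n` ⇒ `x_b ∣ r`
    have h1 : r * X j ^ n ∈ Ideal.span {(X b : MvPolynomial σ K)} :=
      Ideal.mem_span_singleton.mpr ((dvd_mul_left (X b) (X j)).trans hr)
    exact ((isPrime_span_X b).mem_or_mem h1).resolve_right (X_pow_notMem_span_X hbj n)
  · refine le_iSup_of_le 1 ?_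
    intro r hr
    rw [Ideal.colon_span, Submodule.mem_colon_singleton, smul_eq_mul, pow_one, Ideal.mem_span_singleton]
    obtain ⟨q, rfl⟩ := Ideal.mem_span_singleton.mp hr
    exact ⟨q, by ring⟩

omit [DecidableEq σ] in
/-- [OURS] **Strict transform of the chart's own centre hyperplane is empty**: `⋃ₙ ((x_j) : x_jⁿ) = ⊤`. -/
theorem iSup_colon_span_X_self (j : σ) :
    ⨆ n : ℕ, (Ideal.span {(X j : MvPolynomial σ K)}).colon (↑(Ideal.span {(X j : MvPolynomial σ K) ^ n}) : Set (MvPolynomial σ K)) = ⊤ := by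
  refine top_le_iff.mp (le_iSup_of_le 1 ?_)
  intro r _
  rw [Ideal.colon_span, Submodule.mem_colon_singleton, smul_eq_mul, pow_one]
  exact Ideal.mul_mem_left _ r (Ideal.mem_span_singleton_self _)

/-- [OURS] Saturating by the unit ideal does nothing: `⋃ₙ (I : ⊤ⁿ) = I`. -/
theorem iSup_colon_top {R : Type*} [CommRing R] (I : Ideal R) :
    ⨆ n : ℕ, I.colon (↑((⊤ : Ideal R) ^ n) : Set R) = I := by
  apply le_antisymm
  · refine iSup_le fun n => ?_
    intro r hr
    rw [Submodule.mem_colon] at hr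
    have h1 : (1 : R) ∈ ((⊤ : Ideal R) ^ n : Ideal R) := by rw [Ideal.top_pow]; trivial
    have := hr 1 h1
    rwa [smul_eq_mul, mul_one] at this
  · exact le_iSup_of_le 0 Ideal.le_colon

/-- [OURS] Dividing by the unit ideal does nothing: `(I : ⊤ⁿ) = I`. -/
theorem colon_top_pow {R : Type*} [CommRing R] (I : Ideal R) (n : ℕ) : I.colon (↑((⊤ : Ideal R) ^ n) : Set R) = I := by
  apply le_antisymm
  · intro r hr
    rw [Submodule.mem_colon] at hr
    have h1 : (1 : R) ∈ ((⊤ : Ideal R) ^ n : Ideal R) := by rw [Ideal.top_pow]; trivial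
    have := hr 1 h1
    rwa [smul_eq_mul, mul_one] at this
  · exact Ideal.le_colon

/-! ## The controlled transform of a sum of monomials -/

/-- [OURS · Route K, K12] **The controlled transform (marking `m`) of a sum of monomials in the
`j`-chart**: if every `β ∈ A` has `S`-degree `≥ m`, then
`(subst_j (x^β : β ∈ A) : x_j^m) = (x^{β + (|β_{S∖j}|) e_j - m e_j} : β ∈ A)`. -/
theorem colon_map_subst_span_monomial (S : Finset σ) {j : σ} (hj : j ∈ S) (A : Set (σ →₀ ℕ)) (m : ℕ)
    (hA : ∀ β ∈ A, m ≤ sdeg S β) :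
    ((Ideal.span ((fun β => monomial β (1 : K)) '' A)).map (coordBlowupSubst K (S : Set σ) j)).colon
        (↑(Ideal.span {(X j : MvPolynomial σ K) ^ m}) : Set (MvPolynomial σ K)) =
      Ideal.span ((fun β => monomial (β + Finsupp.single j (sdeg (S.erase j) β) - Finsupp.single j m) (1 : K)) '' A) := by
  -- `subst (x^β) = x_j^m · x^{β'}`
  have hgen : (Ideal.span ((fun β => monomial β (1 : K)) '' A)).map (coordBlowupSubst K (S : Set σ) j) =
      Ideal.span {X j ^ m} *
        Ideal.span ((fun β => monomial (β + Finsupp.single j (sdeg (S.erase j) β) - Finsupp.single j m) (1 : K)) '' A) := by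
    rw [Ideal.map_span, ← Set.image_comp, Ideal.span_mul_span', Set.singleton_mul, ← Set.image_comp]
    apply congrArg Ideal.span
    refine Set.image_congr fun β hβ => ?_
    change coordBlowupSubst K (S : Set σ) j (monomial β 1) = X j ^ m * monomial _ 1
    have hle : Finsupp.single j m ≤ β + Finsupp.single j (sdeg (S.erase j) β) :=
      Finsupp.single_le_iff.mpr (by rw [add_single_apply_self_eq_sdeg S hj]; exact hA β hβ)
    rw [coordBlowupSubst_monomial, X_pow_eq_monomial, monomial_mul, one_mul, add_tsub_cancel_of_le hle]
  rw [hgen]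
  have ha : ((X j : MvPolynomial σ K) ^ m) ∈ nonZeroDivisors (MvPolynomial σ K) :=
    pow_mem (mem_nonZeroDivisors_of_ne_zero (X_ne_zero j)) m
  exact colon_span_singleton_mul ha _

end RouteK

end PolyhedraGame

end Summit.ResolutionOfSingularities.ResolutionOfSingularities.Theorems

end
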